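import Summits.BirchSwinnertonDyer.BirchSwinnertonDyer.Theorems.BiquadraticEisensteinDescentHeegnerTwistCouplingInSupplyLinnikCensus
import Summits.BirchSwinnertonDyer.BirchSwinnertonDyer.Theorems.BiquadraticEisensteinDescentHeegnerTwistCouplingInSupplySqrtTwoLawConverse
import HarnessLib

set_option linter.dupNamespace false -- `Summit.BirchSwinnertonDyer.BirchSwinnertonDyer.Theorems.…` (summit = sub)
set_option autoImplicit false

/-!
# Crux `HeegnerTwistCouplingInSupply` (stmt-BirchSwinnertonDyer-21381) — card `linnik-sieve-residual-census`:
# the corner consequence — the pin-free `B_p` rung holds for ALL BUT `O(log⁴ Q)` primes `p ≡ 5 (mod 8)`, `√Q < p ≤ Q`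

Route `BiquadraticEisensteinDescent` (cell `pub/bsd-wall`, width seat `bsd-wall-cm-bed-w3` g19; `--supports` 21381, helper).
Companion of `…LinnikCensus.lean` (★ `residualCensus`: the card's first lemma `ResidualCensus` as an UNCONDITIONAL theorem —
the located-prime exceptional set at height `⌊√Q⌋` has `≤ C log⁴ Q` elements). Here:

* ★ `cornerAlmostAll` — the CONSEQUENT of the card's `CornerAlmostAll`, unconditionally (no `ResidualCensus →` premiss left):
  all but `C log⁴ Q` primes `p ≡ 5 (mod 8)` with `⌊√Q⌋ < p ≤ Q` carry a located prime `ℓ ≡ 7 (mod 16)`, `ℓ < 6p`,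
  `(p/ℓ) = +1` (a located prime `ℓ ≤ ⌊√Q⌋ < p` is `< 6p`);
* ★★ `cruxConclusion_Bp_allBut_of_two_facts` — glue to the door theorem
  `…SqrtTwoLawConverse.cruxOnBpCornerPrimeTwist_of_two_facts`: modulo EXACTLY its two named facts (Burungale–Tian
  `burungaleTian_analyticRank_eq_zero_of_selmerCorank_eq_zero_of_hasCM`, Deuring–Hecke continuation
  `hasEntireLFunction_of_j_mem_maximalCMJInvariants`), for every `Q ≥ 3` there is an exceptional set `E` of `≤ C log⁴ Q`
  primes outside which EVERY prime `p ≡ 5 (mod 8)`, `p ≠ 5`, `⌊√Q⌋ < p ≤ Q` satisfies the conclusion of crux 21381 for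
  `W = B_p : y² = x³ + 4px² + 2p²x` (a Heegner field `K′` of `N(B_p)` with `4 < |d_{K′}|`, `L(B_p^{(d_{K′})}, 1) ≠ 0`,
  `h(K′) < p`, `p ∤ h(K′)`). The constant `C` is the one of `residualCensus` (absolute, from Montgomery's large sieve and the
  PNT in the progression `7 (mod 16)`; not optimised).

HONEST FRAMING: RUNG-LEVEL («all but `O(log⁴ Q)` of the `p ≡ 5 (mod 8)` corner primes at `j = 8000`»), not the class, not
the crux: the crux as stated (all CM `W`, all `p ≥ 5`; residual C⁺) and its registered stubs are untouched, and BSD is not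
proved by any of this. THEOREMS ONLY; `--supports` stmt-BirchSwinnertonDyer-21381 (helper).
-/

namespace Summit.BirchSwinnertonDyer.BirchSwinnertonDyer.Theorems.LinnikCensus

open Finset
open _root_.WeierstrassCurve Literature.NumberTheory.EllipticCurves
open Summit.BirchSwinnertonDyer.BirchSwinnertonDyer.Theorems.BiquadraticEisensteinDescentHeegnerTwistCouplingInSupplySqrtTwoCorner
  (isElliptic_Bfam)
open Summit.BirchSwinnertonDyer.BirchSwinnertonDyer.Theorems.BiquadraticEisensteinDescentHeegnerTwistCouplingInSupplySqrtTwoLawConverse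
  (cruxOnBpCornerPrimeTwist_of_two_facts)

open scoped Classical in
/-- **Outside the exceptional set there is a located prime below `6p`**: a prime `p` with `⌊√Q⌋ < p ≤ Q`, `p ≡ 5 (mod 8)`,
NOT in the exceptional set of `residualCensus` has a prime `ℓ ≡ 7 (mod 16)`, `ℓ ≤ ⌊√Q⌋` (so `ℓ < 6p`), with `(p/ℓ) = +1`
(the card's bookkeeping `located_of_not_mem`, by value). [folklore] -/
theorem exists_located_of_not_mem {Q p : ℕ} (hp : p.Prime) (hp8 : p % 8 = 5) (hyp : Nat.sqrt Q < p) (hpQ : p ≤ Q)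
    (h : p ∉ (Finset.range (Q + 1)).filter (fun p : ℕ => p.Prime ∧ p % 8 = 5 ∧ Nat.sqrt Q < p ∧
        ∀ ℓ : ℕ, ℓ.Prime → ℓ % 16 = 7 → ℓ ≤ Nat.sqrt Q → jacobiSym (p : ℤ) ℓ ≠ 1)) :
    ∃ ℓ : ℕ, ℓ.Prime ∧ ℓ % 16 = 7 ∧ ℓ ≤ Nat.sqrt Q ∧ ℓ < 6 * p ∧ jacobiSym (p : ℤ) ℓ = 1 := by
  by_contra hne
  apply h
  rw [Finset.mem_filter, Finset.mem_range]
  refine ⟨by omega, hp, hp8, hyp, ?_⟩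
  intro ℓ hℓ h16 hle hJ
  exact hne ⟨ℓ, hℓ, h16, hle, by omega, hJ⟩

open scoped Classical in
/-- ★ **`cornerAlmostAll`** — the consequent of the card's `CornerAlmostAll`, UNCONDITIONALLY: there is `C > 0` such that for
every `Q ≥ 3`, all but at most `C · (log Q)⁴` primes `p ≤ Q` with `p ≡ 5 (mod 8)` and `⌊√Q⌋ < p` admit a located prime
`ℓ ≡ 7 (mod 16)`, `ℓ < 6p`, `(p/ℓ) = +1` (the hypotheses `hℓ16`, `hℓp`, `hJ` of the door theorem
`cruxOnBpCornerPrimeTwist_of_two_facts`). Proof: such a `p` without a located `ℓ < 6p` has none `≤ ⌊√Q⌋ < p < 6p`, so it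
lies in the exceptional set of `residualCensus`. [cite: Montgomery1978, p. 561] [cite: MontgomeryVaughan2007, Cor. 11.17] -/
theorem cornerAlmostAll :
    ∃ C : ℝ, 0 < C ∧ ∀ Q : ℕ, 3 ≤ Q →
      (((Finset.range (Q + 1)).filter (fun p : ℕ => p.Prime ∧ p % 8 = 5 ∧ Nat.sqrt Q < p ∧
          ¬ ∃ ℓ : ℕ, ℓ.Prime ∧ ℓ % 16 = 7 ∧ ℓ < 6 * p ∧ jacobiSym (p : ℤ) ℓ = 1)).card : ℝ)
        ≤ C * Real.log Q ^ 4 := by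
  obtain ⟨C, hC, hcensus⟩ := residualCensus
  refine ⟨C, hC, fun Q hQ => le_trans ?_ (hcensus Q hQ)⟩
  exact_mod_cast Finset.card_le_card (fun p hp => by
    rw [Finset.mem_filter, Finset.mem_range] at hp ⊢
    obtain ⟨hpQ, hpp, hp8, hyp, hno⟩ := hp
    refine ⟨hpQ, hpp, hp8, hyp, fun ℓ hℓ h16 hle hJ => hno ⟨ℓ, hℓ, h16, by omega, hJ⟩⟩)

open scoped Classical in
/-- ★★ **The `B_p` rung for all but `O(log⁴ Q)` primes, modulo the door's two facts.** Granted Burungale–Tian (`p`-converse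
for CM curves, `burungaleTian_analyticRank_eq_zero_of_selmerCorank_eq_zero_of_hasCM`) and the Deuring–Hecke continuation
(`hasEntireLFunction_of_j_mem_maximalCMJInvariants`) — exactly the hypotheses of
`…SqrtTwoLawConverse.cruxOnBpCornerPrimeTwist_of_two_facts` — there is an absolute `C > 0` such that for every `Q ≥ 3`
some set `E` of at most `C · (log Q)⁴` naturals has the property: EVERY prime `p ≡ 5 (mod 8)`, `p ≠ 5`, `⌊√Q⌋ < p ≤ Q`,
`p ∉ E`, satisfies the conclusion of crux `HeegnerTwistCouplingInSupply` for `W = B_p : y² = x³ + 4px² + 2p²x` — an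
imaginary quadratic `K′ = ℚ(√−ℓ)`, `4 < |d_{K′}|`, Heegner for `N(B_p)`, `L(B_p^{(d_{K′})}, 1) ≠ 0`, `h(K′) < p`,
`p ∤ h(K′)`. `E` is the exceptional set of `residualCensus` (Montgomery's large sieve + PNT for `7 (mod 16)`, both proved in
the tree); the located prime it supplies feeds the door. RUNG-LEVEL; the crux (all `W`, all `p`) is NOT closed; BSD is not
proved. [cite: Montgomery1978, p. 561] [cite: BurungaleTian2026, Thm. 1.1] [cite: SilvermanAEC2009, Prop. X.4.9] -/
theorem cruxConclusion_Bp_allBut_of_two_facts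
    (hBT : burungaleTian_analyticRank_eq_zero_of_selmerCorank_eq_zero_of_hasCM)
    (hH : hasEntireLFunction_of_j_mem_maximalCMJInvariants) :
    ∃ C : ℝ, 0 < C ∧ ∀ Q : ℕ, 3 ≤ Q → ∃ E : Finset ℕ, (E.card : ℝ) ≤ C * Real.log Q ^ 4 ∧
      ∀ p : ℕ, p.Prime → p % 8 = 5 → p ≠ 5 → Nat.sqrt Q < p → p ≤ Q → p ∉ E →
        ∃ (K : Type) (_ : Field K) (_ : NumberField K),
          IsImaginaryQuadratic K ∧ 4 < (NumberField.discr K).natAbs ∧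
          SatisfiesHeegnerHypothesis
            ((⟨0, 4 * (p : ℚ), 0, 2 * (p : ℚ) ^ 2, 0⟩ : WeierstrassCurve ℚ).conductorNorm ℤ) K ∧
          ((⟨0, 4 * (p : ℚ), 0, 2 * (p : ℚ) ^ 2, 0⟩ : WeierstrassCurve ℚ).quadraticTwist
              (NumberField.discr K : ℚ)).entireLFunction 1 ≠ 0 ∧
          NumberField.classNumber K < p ∧ ¬ p ∣ NumberField.classNumber K := by
  obtain ⟨C, hC, hcensus⟩ := residualCensus
  refine ⟨C, hC, fun Q hQ => ⟨_, hcensus Q hQ, ?_⟩⟩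
  intro p hp hp8 h5 hyp hpQ hpE
  obtain ⟨ℓ, hℓ, h16, -, hℓp, hJ⟩ := exists_located_of_not_mem hp hp8 hyp hpQ hpE
  haveI := isElliptic_Bfam (n := (p : ℚ)) (by exact_mod_cast hp.ne_zero)
  obtain ⟨K, iF, iN, hIQ, -, h4, hHeeg, hL, hlt, hndvd⟩ :=
    cruxOnBpCornerPrimeTwist_of_two_facts hBT hH hp hp8 h5 hℓ h16 hℓp hJ
  exact ⟨K, iF, iN, hIQ, h4, hHeeg, hL, hlt, hndvd⟩

open Summit.BirchSwinnertonDyer.BirchSwinnertonDyer.Theorems.BiquadraticEisensteinDescentHeegnerTwistCouplingInSupplySqrtTwoLawConverse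
  (cruxOnBdualCornerPrimeTwist_of_two_facts) in
open scoped Classical in
/-- ★★ **The dual `B_{−2p}` rung for all but `O(log⁴ Q)` primes, modulo the door's two facts** (appended). The SAME exceptional
set serves the dual member of the `√2` corner: the door `…SqrtTwoLawConverse.cruxOnBdualCornerPrimeTwist_of_two_facts`
(`W = B_{−2p} : y² = x³ − 8px² + 8p²x`, CELL-7′) consumes the same located prime `ℓ ≡ 7 (mod 16)`, `ℓ < 6p`, `(p/ℓ) = +1`.
Hence, granted Burungale–Tian and the Deuring–Hecke continuation, for every `Q ≥ 3` some set `E` of at most `C · (log Q)⁴`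
naturals has: EVERY prime `p ≡ 5 (mod 8)`, `p ≠ 5`, `⌊√Q⌋ < p ≤ Q`, `p ∉ E` (and `B_{−2p}` elliptic, the door's instance binder)
satisfies the conclusion of crux 21381 for `W = B_{−2p}`. RUNG-LEVEL; the crux is NOT closed; BSD is not proved.
[cite: Montgomery1978, p. 561] [cite: BurungaleTian2026, Thm. 1.1] [cite: SilvermanAEC2009, Prop. X.4.9] -/
theorem cruxConclusion_Bdual_allBut_of_two_facts
    (hBT : burungaleTian_analyticRank_eq_zero_of_selmerCorank_eq_zero_of_hasCM)
    (hH : hasEntireLFunction_of_j_mem_maximalCMJInvariants) :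
    ∃ C : ℝ, 0 < C ∧ ∀ Q : ℕ, 3 ≤ Q → ∃ E : Finset ℕ, (E.card : ℝ) ≤ C * Real.log Q ^ 4 ∧
      ∀ (p : ℕ) [(⟨0, -8 * (p : ℚ), 0, 8 * (p : ℚ) ^ 2, 0⟩ : WeierstrassCurve ℚ).IsElliptic],
        p.Prime → p % 8 = 5 → p ≠ 5 → Nat.sqrt Q < p → p ≤ Q → p ∉ E →
        ∃ (K : Type) (_ : Field K) (_ : NumberField K),
          IsImaginaryQuadratic K ∧ 4 < (NumberField.discr K).natAbs ∧
          SatisfiesHeegnerHypothesis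
            ((⟨0, -8 * (p : ℚ), 0, 8 * (p : ℚ) ^ 2, 0⟩ : WeierstrassCurve ℚ).conductorNorm ℤ) K ∧
          ((⟨0, -8 * (p : ℚ), 0, 8 * (p : ℚ) ^ 2, 0⟩ : WeierstrassCurve ℚ).quadraticTwist
              (NumberField.discr K : ℚ)).entireLFunction 1 ≠ 0 ∧
          NumberField.classNumber K < p ∧ ¬ p ∣ NumberField.classNumber K := by
  obtain ⟨C, hC, hcensus⟩ := residualCensus
  refine ⟨C, hC, fun Q hQ => ⟨_, hcensus Q hQ, ?_⟩⟩
  intro p _ hp hp8 h5 hyp hpQ hpE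
  obtain ⟨ℓ, hℓ, h16, -, hℓp, hJ⟩ := exists_located_of_not_mem hp hp8 hyp hpQ hpE
  obtain ⟨K, iF, iN, hIQ, -, h4, hHeeg, hL, hlt, hndvd⟩ :=
    cruxOnBdualCornerPrimeTwist_of_two_facts hBT hH hp hp8 h5 hℓ h16 hℓp hJ
  exact ⟨K, iF, iN, hIQ, h4, hHeeg, hL, hlt, hndvd⟩

end Summit.BirchSwinnertonDyer.BirchSwinnertonDyer.Theorems.LinnikCensus
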